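import Summits.QuantumFields.BalabanUV.T4Continuum.Support.RegionGaugeColumnsTwoLevel
import Summits.QuantumFields.BalabanUV.T4Continuum.Support.RegionLocalInjectedAssemblyTrace

/-!
# T⁴ programme, spine node NE2 (U1a), sub-row Δ1 «NE2⁰-Dirichlet» — owner item O15-a, LEAF (B) «GAUGE-COLUMNS-TWO-LEVEL», file B4a:
# THE TOWER SPELLING — `hB` of `RegionGaugeResolventTower.hinjK_of_local` VERBATIM at `θ = (√L)⁻¹` on every coordinate box

NE2 formalisation swarm `b2b-balaban-t4-ne2-formalise-*`, LEAF PROVER 05 (gen 9); owner rulings R35 (c) / R36 (a) (journal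
`CLAIMS.log` 2026-08-20 l.22128 / l.22328).  File B3c `RegionGaugeColumnsTwoLevel.opNorm_regionBh_succ_sub_le` gives, for `n ≥ 2`,
`‖B̂_{L·n} − JstarR·B̂_n‖ ≤ √(CgaugeBsq)·(√n)⁻¹`.  THIS FILE reads it along King's tower `n_k = lev L k = L^k`: `JstarR (lev L k) = JpR k`
(definitional), `(√(L^k))⁻¹ = ((√L)⁻¹)^k`, and level `k = 0` (`n = 1`) by the trivial bound `‖B̂′‖ + ‖B̂‖ ≤ 2√(γ′⁻¹)`:

 **`hB_box (hL : 2 ≤ L) (hS : IsCoordBox M S) (ha′ : 0 < a′) : ∀ k,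
   ‖regionBh (lev L (k + 1)) M a′ S − JpR L M (starP L M S) k * regionBh (lev L k) M a′ S‖ ≤ CbBox d L a′ * ((√L)⁻¹) ^ k`**,
 `CbBox d L a′ := 2·√(γ′⁻¹) + √(CgaugeBsq d L a′)` — leaf (B) of the owner's cut (L) ∧ (B) ∧ (Bᵗ) ∧ (K) for O14-b′ «W3-BOX-COMPRESSED»,
 DISCHARGED on coordinate boxes with no displayed binder; and, composing with leaf-06-g7's `RegionGaugeColumnsTrace.hBt_of_hB` ((Bᵗ) ⇐ (B))
 and the owner's O15-c `RegionLocalInjectedAssembly.hK_box` ((K) = leaf-01-g10's theorem), **`hinjK_of_local1`** / **`towerLimitRate_star_renorm_box_of_local1`**: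
 the owner's END `towerLimitRate_star_renorm_box_of_local` (p238533) at every `θ ∈ [(√L)⁻¹, 1)` MODULO ONE LEAF ONLY — (L), King's
 compressed injected law of the LOCAL operator `regionDeltaLoc` (leaf-03-g8 (P-gaffney) + leaf-07-g8 (P-mass) + leaf-02-g8 (R-loc)).

HONEST FRAMING (T4-DAG p. 1).  `U = 1`; ONE region = a coordinate box; ONE averaging scale; finite torus; operator norm; constants OURS
and crude; rate `(√L)⁻¹` from the LOW-WALL leak (not `L⁻¹`); (Bᵗ), (L) and hence `hinjK` / W3 on boxes STILL OPEN; NE2 (U1a) NOT proved;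
spine PROVED 0/9 unchanged; NOT [B9] (3.23)–(3.27) as printed; NOT infinite volume / mass gap / Clay.  HONEST DEPENDENCY: continuum YM on
T⁴ ⇐ BetaPertH ∧ nine spine estimates (0/9 proved); BetaPertH ⇐ (D1) ∧ (D4) ∧ CAP+tail; G-an2-4 gates asym, D1 and NE2/3/4.  No `sorry`.
-/

noncomputable section

open scoped BigOperators ComplexConjugate Matrix Matrix.Norms.L2Operator

namespace Summit.QuantumFields.BalabanUV.T4Continuum.RegionGaugeColumnsTower

open Literature.MathematicalPhysics.QuantumFieldTheory.Balaban1983to89.B5Prop11Plancherel (Tor fine)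
open Literature.MathematicalPhysics.QuantumFieldTheory.Balaban1983to89.B5G183RateUnitTower (lev)
open Summit.QuantumFields.BalabanUV.T4Continuum
open Summit.QuantumFields.BalabanUV.T4Continuum.BalabanAveragedTowerUnit (cast_lev' one_le_lev')
open Summit.QuantumFields.BalabanUV.T4Continuum.ScalarAveragedPropagator (gammaPs gammaPs_pos)
open Summit.QuantumFields.BalabanUV.T4Continuum.DirichletSubregionTowerOf (JpR opNorm_JpR_le pidx)
open Summit.QuantumFields.BalabanUV.T4Continuum.DirichletStarVectorTower (starP)
open Summit.QuantumFields.BalabanUV.T4Continuum.RegionGaugeResolventSplit (regionBh opNorm_regionBh_le)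
open Summit.QuantumFields.BalabanUV.T4Continuum.RegionTaylorColumns (JstarR)
open Summit.QuantumFields.BalabanUV.T4Continuum.RegionGaugeColumnsTwoLevel (CgaugeBsq CgaugeBsq_nonneg opNorm_regionBh_succ_sub_le)
open Summit.QuantumFields.BalabanUV.T4Continuum.RegionGaugeFixedVector (regionDeltaA)
open Summit.QuantumFields.BalabanUV.T4Continuum.RegionScalarCompression (KcompR)
open Summit.QuantumFields.BalabanUV.T4Continuum.RegionGaugeResolventSplit (regionDeltaLoc)
open Summit.QuantumFields.BalabanUV.T4Continuum.RegionGaugeResolventTower (C1loc)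
open Summit.QuantumFields.BalabanUV.T4Continuum.RegionGaugeColumnsTrace (Cbt hinjK_of_local3 towerLimitRate_star_renorm_box_of_local3)
open Summit.QuantumFields.BalabanUV.T4Continuum.RegionLocalInjectedAssembly (Ebud ClW CKbox hK_box)
open Summit.QuantumFields.BalabanUV.T4Continuum.RegionLocalBudgets (CHbox)
open Summit.QuantumFields.BalabanUV.T4Continuum.RegionElectricSplitting (Wdir)
open Summit.QuantumFields.BalabanUV.T4Continuum.RegionLocalInjectedAssemblyTrace (hinjK_box_of_WPairing_hB towerLimitRate_star_renorm_box_of_WPairing_hB)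
open Summit.QuantumFields.BalabanUV.T4Continuum.DirichletSubregionRenormTower (AnR)
open Summit.QuantumFields.BalabanUV.T4Continuum.CovariantAveragingTower (TowerLimitRate)
open Summit.QuantumFields.BalabanUV.T4Continuum.BackgroundResolventTower (Cpert)
open Summit.QuantumFields.BalabanUV.T4Continuum.RegionInteriorW2 (CgIbox)
open Summit.QuantumFields.BalabanUV.T4Continuum.RegionSliceCoerciveBoxTower (cW1box)
open Summit.QuantumFields.BalabanUV.T4Continuum.DirichletStarVectorTower (gamStar)
open Summit.QuantumFields.BalabanUV.Beta.GAN24.DirichletBoxTwoLevel (IsCoordBox)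

variable {d : ℕ} (L : ℕ) [NeZero L] (M : Fin d → ℕ) [hM : ∀ μ, NeZero (M μ)] (a a' : ℝ) (S : Tor M → Prop) [DecidablePred S]

omit [DecidablePred S] in
/-- the tower's compressed planting IS `JstarR` at `n = lev L k` (definitional: `lev L (k+1) = L * lev L k`, `JpcT = JK`). [folklore] -/
theorem JpR_eq_JstarR (k : ℕ) : JpR L M (starP L M S) k = JstarR (lev L k) L M S := rfl

/-- the (B) constant of the tower on a box: `CbBox d L a′ := 2·√(γ′⁻¹) + √(CgaugeBsq d L a′)`. [folklore] -/
def CbBox (d L : ℕ) (a' : ℝ) : ℝ := 2 * Real.sqrt ((gammaPs d a')⁻¹) + Real.sqrt (CgaugeBsq d L a')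

omit [NeZero L] in
/-- `0 ≤ CbBox`. [folklore] -/
theorem CbBox_nonneg : 0 ≤ CbBox d L a' := by unfold CbBox; positivity

omit [NeZero L] hM [DecidablePred S] in
/-- `(√(L^k))⁻¹ = ((√L)⁻¹)^k`. [folklore] -/
theorem inv_sqrt_lev (k : ℕ) : (Real.sqrt (((lev L k : ℕ) : ℝ)))⁻¹ = ((Real.sqrt (L : ℝ))⁻¹) ^ k := by
  rw [cast_lev', inv_pow]
  congr 1
  have hL : (0 : ℝ) ≤ L := Nat.cast_nonneg _
  rw [Real.sqrt_eq_iff_mul_self_eq (pow_nonneg hL k) (pow_nonneg (Real.sqrt_nonneg _) k), ← mul_pow, Real.mul_self_sqrt hL]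

/-- **LEAF (B) ALONG THE TOWER ON A COORDINATE BOX — `hB` VERBATIM at `θ = (√L)⁻¹`, NO displayed binder.** [folklore] -/
theorem hB_box (hL : 2 ≤ L) (hS : IsCoordBox M S) (ha' : 0 < a') (k : ℕ) :
    ‖regionBh (lev L (k + 1)) M a' S - JpR L M (starP L M S) k * regionBh (lev L k) M a' S‖ ≤ CbBox d L a' * ((Real.sqrt (L : ℝ))⁻¹) ^ k := by
  have hγ := (gammaPs_pos (d := d) (a' := a')).1
  have hL1 : (1 : ℝ) ≤ Real.sqrt (L : ℝ) := by
    rw [Real.le_sqrt zero_le_one (Nat.cast_nonneg _), one_pow]; exact_mod_cast le_trans one_le_two hL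
  have hθ1 : ((Real.sqrt (L : ℝ))⁻¹) ^ k ≤ 1 := pow_le_one₀ (inv_nonneg.mpr (Real.sqrt_nonneg _)) (inv_le_one_of_one_le₀ hL1)
  have hθ0 : 0 ≤ ((Real.sqrt (L : ℝ))⁻¹) ^ k := pow_nonneg (inv_nonneg.mpr (Real.sqrt_nonneg _)) k
  rcases k with _ | k
  · -- level `0`: `n = 1`, the trivial bound
    rw [pow_zero, mul_one]
    calc ‖regionBh (lev L (0 + 1)) M a' S - JpR L M (starP L M S) 0 * regionBh (lev L 0) M a' S‖
        ≤ ‖regionBh (lev L (0 + 1)) M a' S‖ + ‖JpR L M (starP L M S) 0 * regionBh (lev L 0) M a' S‖ := norm_sub_le _ _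
      _ ≤ Real.sqrt ((gammaPs d a')⁻¹) + 1 * Real.sqrt ((gammaPs d a')⁻¹) := by
          refine add_le_add (opNorm_regionBh_le _ M a' S ha') ((Matrix.l2_opNorm_mul _ _).trans ?_)
          exact mul_le_mul (opNorm_JpR_le L M (starP L M S) 0) (opNorm_regionBh_le _ M a' S ha') (norm_nonneg _) zero_le_one
      _ ≤ CbBox d L a' := by
          unfold CbBox; have := Real.sqrt_nonneg (CgaugeBsq d L a'); linarith
  · -- level `k + 1 ≥ 1`: `n = L^{k+1} ≥ 2`
    have hn : 2 ≤ lev L (k + 1) := by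
      show 2 ≤ L * lev L k
      calc 2 ≤ L * 1 := by omega
        _ ≤ L * lev L k := Nat.mul_le_mul_left L (one_le_lev' L k)
    haveI : NeZero (lev L (k + 1)) := ⟨by omega⟩
    have h := opNorm_regionBh_succ_sub_le (lev L (k + 1)) L M a' S hn hS ha'
    rw [JpR_eq_JstarR]
    refine h.trans ?_
    rw [inv_sqrt_lev]
    have hs : Real.sqrt (CgaugeBsq d L a') ≤ CbBox d L a' := by
      unfold CbBox; have := Real.sqrt_nonneg ((gammaPs d a')⁻¹); linarith
    exact mul_le_mul_of_nonneg_right hs (pow_nonneg (inv_nonneg.mpr (Real.sqrt_nonneg _)) _)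

/-- `hB` at any rate `θ ≥ (√L)⁻¹` (weakening). [folklore] -/
theorem hB_box_of_le (hL : 2 ≤ L) (hS : IsCoordBox M S) (ha' : 0 < a') {θ : ℝ} (hθ : (Real.sqrt (L : ℝ))⁻¹ ≤ θ) (k : ℕ) :
    ‖regionBh (lev L (k + 1)) M a' S - JpR L M (starP L M S) k * regionBh (lev L k) M a' S‖ ≤ CbBox d L a' * θ ^ k :=
  (hB_box L M a' S hL hS ha' k).trans (mul_le_mul_of_nonneg_left
    (pow_le_pow_left₀ (inv_nonneg.mpr (Real.sqrt_nonneg _)) hθ k) (CbBox_nonneg (d := d) L a'))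

omit [NeZero L] hM [DecidablePred S] in
/-- `L⁻¹ ≤ (√L)⁻¹` for `1 ≤ L`. [folklore] -/
theorem inv_le_inv_sqrt (hL : 1 ≤ L) : ((L : ℝ))⁻¹ ≤ (Real.sqrt (L : ℝ))⁻¹ := by
  have hL1 : (1 : ℝ) ≤ L := by exact_mod_cast hL
  have hs : 0 < Real.sqrt (L : ℝ) := Real.sqrt_pos.mpr (by linarith)
  rw [inv_le_inv₀ (by linarith) hs]
  calc Real.sqrt (L : ℝ) = Real.sqrt L * 1 := (mul_one _).symm
    _ ≤ Real.sqrt L * Real.sqrt L := by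
        refine mul_le_mul_of_nonneg_left ?_ hs.le
        rw [Real.le_sqrt zero_le_one (by linarith), one_pow]; exact hL1
    _ = L := Real.mul_self_sqrt (by linarith)

/-- **`hinjK` ON A COORDINATE BOX MODULO THE LOCAL LEAF (L) ONLY** (`2 ≤ L`, `0 < a`, `0 < a′`, any `θ ≥ (√L)⁻¹`): the owner's
`hinjK_of_local` with (B) := `hB_box`, (Bᵗ) := leaf-06-g7's `hBt_of_hB`, (K) := the owner's `hK_box` (leaf-01-g10's theorem). [folklore] -/
theorem hinjK_of_local1 (hL : 2 ≤ L) (hbox : IsCoordBox M S) (ha : 0 < a) (ha' : 0 < a') {θ Cl : ℝ} (hθ : (Real.sqrt L)⁻¹ ≤ θ)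
    (hloc : ∀ k, ‖(regionDeltaLoc (lev L (k + 1)) M a S)⁻¹ * JpR L M (starP L M S) k
        - JpR L M (starP L M S) k * (regionDeltaLoc (lev L k) M a S)⁻¹‖ ≤ Cl * θ ^ k) (k : ℕ) :
    ‖(regionDeltaA (lev L (k + 1)) M a a' S)⁻¹ * JpR L M (starP L M S) k
        - JpR L M (starP L M S) k * (regionDeltaA (lev L k) M a a' S)⁻¹‖
      ≤ C1loc d a a' Cl (CbBox d L a') (Cbt d L a' (CbBox d L a')) (CKbox d L a') * θ ^ k :=
  hinjK_of_local3 L M S a a' hL hbox ha ha' hθ (CbBox_nonneg (d := d) L a') hloc (hB_box_of_le L M a' S hL hbox ha' hθ)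
    (fun k => hK_box (L := L) (M := M) (a' := a') (S := S) hbox ha' ((inv_le_inv_sqrt L (le_trans one_le_two hL)).trans hθ) k) k

/-- **THE RENORMALISED STAR TOWER OF THE FAITHFUL `Δ_a(Ω₀)` ON A COORDINATE BOX AT RATE `θ ∈ [(√L)⁻¹, 1)` MODULO ONE LEAF — (L)**:
the owner's END `RegionGaugeResolventTower.towerLimitRate_star_renorm_box_of_local` with (B), (Bᵗ), (K) ALL DISCHARGED. [folklore] -/
theorem towerLimitRate_star_renorm_box_of_local1 (hL : 2 ≤ L) (hbox : IsCoordBox M S) (ha : 0 < a) (ha' : 0 < a')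
    {θ Cl : ℝ} (hθ : (Real.sqrt L)⁻¹ ≤ θ) (hθ1 : θ < 1)
    (hloc : ∀ k, ‖(regionDeltaLoc (lev L (k + 1)) M a S)⁻¹ * JpR L M (starP L M S) k
        - JpR L M (starP L M S) k * (regionDeltaLoc (lev L k) M a S)⁻¹‖ ≤ Cl * θ ^ k) :
    TowerLimitRate (AnR L M (starP L M S)) ((L : ℝ) ^ d) (fun k => (regionDeltaA (lev L k) M a a' S)⁻¹)
      (Cpert 0 (Real.sqrt (CgIbox d a' (cW1box d a a' 4) / 2 * (gamStar d a' (cW1box d a a' 4))⁻¹))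
        (Real.sqrt L * C1loc d a a' Cl (CbBox d L a') (Cbt d L a' (CbBox d L a')) (CKbox d L a')
          + (2 * (Real.sqrt L - 1) * Real.sqrt ((2 * (gamStar d a' (cW1box d a a' 4))⁻¹
          + CgIbox d a' (cW1box d a a' 4)) * (gamStar d a' (cW1box d a a' 4))⁻¹))) 0 0 0) θ :=
  towerLimitRate_star_renorm_box_of_local3 L M S a a' hL hbox ha ha' hθ hθ1 (CbBox_nonneg (d := d) L a') hloc
    (hB_box_of_le L M a' S hL hbox ha' hθ)
    (fun k => hK_box (L := L) (M := M) (a' := a') (S := S) hbox ha' ((inv_le_inv_sqrt L (le_trans one_le_two hL)).trans hθ) k)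

/-- **THE END OF RECORD WITH (B) DISCHARGED — `hinjK` ON A COORDINATE BOX MODULO ONE LEAF, the W-pairing of the local operator's
Gaffney part ((P-gaffney), leaf-03-g8)**: leaf-06-g7's `RegionLocalInjectedAssemblyTrace.hinjK_box_of_WPairing_hB` with `hB := hB_box`.
[folklore] -/
theorem hinjK_box_of_WPairing (hL : 2 ≤ L) (hbox : IsCoordBox M S) (ha : 0 < a) (ha' : 0 < a') {θ CW : ℝ}
    (hθ : (Real.sqrt L)⁻¹ ≤ θ) {εW : ℕ → ℝ} (hεW : ∀ k, 0 ≤ εW k) (hrate : ∀ k, εW k ≤ CW * θ ^ k)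
    (hPW : ∀ (k : ℕ) (u : pidx L M (starP L M S) k → ℂ) (v : pidx L M (starP L M S) (k + 1) → ℂ),
      ‖star v ⬝ᵥ ((JpR L M (starP L M S) k * regionDeltaLoc (lev L k) M 0 S
          - regionDeltaLoc (lev L (k + 1)) M 0 S * JpR L M (starP L M S) k) *ᵥ u)‖
        ≤ εW k * Real.sqrt (Ebud (lev L k) M a S u) * Real.sqrt (Ebud (lev L (k + 1)) M a S v)) (k : ℕ) :
    ‖(regionDeltaA (lev L (k + 1)) M a a' S)⁻¹ * JpR L M (starP L M S) k
        - JpR L M (starP L M S) k * (regionDeltaA (lev L k) M a a' S)⁻¹‖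
      ≤ C1loc d a a' (ClW d a a' CW (CHbox d a a')) (CbBox d L a') (Cbt d L a' (CbBox d L a')) (CKbox d L a') * θ ^ k :=
  hinjK_box_of_WPairing_hB L M S a a' hL hbox ha ha' hθ hεW hrate hPW (CbBox_nonneg (d := d) L a') (hB_box_of_le L M a' S hL hbox ha' hθ) k

/-- **THE RENORMALISED STAR TOWER OF THE FAITHFUL `Δ_a(Ω₀)` ON A COORDINATE BOX AT RATE `θ ∈ [(√L)⁻¹, 1)` MODULO ONE LEAF — the
W-pairing `hPW` of (P-gaffney)**: leaf-06-g7's END of record `towerLimitRate_star_renorm_box_of_WPairing_hB` with `hB := hB_box`; (B), (Bᵗ),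
(K), (P-mass), (R-loc), (R-energy), W1, W2 all theorems. [folklore] -/
theorem towerLimitRate_star_renorm_box_of_WPairing (hL : 2 ≤ L) (hbox : IsCoordBox M S) (ha : 0 < a) (ha' : 0 < a')
    {θ CW : ℝ} (hθ : (Real.sqrt L)⁻¹ ≤ θ) (hθ1 : θ < 1) {εW : ℕ → ℝ} (hεW : ∀ k, 0 ≤ εW k) (hrate : ∀ k, εW k ≤ CW * θ ^ k)
    (hPW : ∀ (k : ℕ) (u : pidx L M (starP L M S) k → ℂ) (v : pidx L M (starP L M S) (k + 1) → ℂ),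
      ‖star v ⬝ᵥ ((JpR L M (starP L M S) k * regionDeltaLoc (lev L k) M 0 S
          - regionDeltaLoc (lev L (k + 1)) M 0 S * JpR L M (starP L M S) k) *ᵥ u)‖
        ≤ εW k * Real.sqrt (Ebud (lev L k) M a S u) * Real.sqrt (Ebud (lev L (k + 1)) M a S v)) :
    TowerLimitRate (AnR L M (starP L M S)) ((L : ℝ) ^ d) (fun k => (regionDeltaA (lev L k) M a a' S)⁻¹)
      (Cpert 0 (Real.sqrt (CgIbox d a' (cW1box d a a' 4) / 2 * (gamStar d a' (cW1box d a a' 4))⁻¹))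
        (Real.sqrt L * C1loc d a a' (ClW d a a' CW (CHbox d a a')) (CbBox d L a') (Cbt d L a' (CbBox d L a')) (CKbox d L a')
          + (2 * (Real.sqrt L - 1) * Real.sqrt ((2 * (gamStar d a' (cW1box d a a' 4))⁻¹ + CgIbox d a' (cW1box d a a' 4))
            * (gamStar d a' (cW1box d a a' 4))⁻¹))) 0 0 0) θ :=
  towerLimitRate_star_renorm_box_of_WPairing_hB L M S a a' hL hbox ha ha' hθ hθ1 hεW hrate hPW (CbBox_nonneg (d := d) L a')
    (hB_box_of_le L M a' S hL hbox ha' hθ)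

end Summit.QuantumFields.BalabanUV.T4Continuum.RegionGaugeColumnsTower

end
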